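import Summits.QuantumFields.YangMills.Theorems.BalabanUVNodesN15KingModelGraphTreeDecayPseudoforest

/-!
# BalabanUVNodes ∕ N15 — THE KING-MODEL RUNG (PART Β-a): EXTENSIVITY — THE LATTICE PARTITION OF UNITY (3.36)–(3.37) AS BLOCK-INDICATOR ONE-VERTEX FACTORS, AND
# (3.56) ⇒ «`C·L^{−γk}·|T|`» (THE SHAPE OF THEOREM 3.4 (3.9)) FOR VACUUM DIAGRAMS, BY NAME AT `A = 0`
# (Track A, DAG node N15 = NE2; FAN-OUT v1.1 §N15 s3 «KING-MODEL RUNG … NE2's analogue DECIDED in the model»)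

HONEST FRAMING.  Count-neutral (cell `pub-ymgap`, seat `pub-ymgap-dag-n15-e` g30; `--supports stmt-QuantumFields-27366 --as helper` = K3⁸
`SpineGivenEndpointR13SepCoPHV`).  TEMPLATE LITERATURE: C. King, *The U(1) Higgs model. I. The continuum limit*, Commun. Math. Phys. **102** (1986) 649–677
[King1986]: Theorem 3.4 (3.9) p. 656 (the shape `C(L^{−γk}…)|T|`), the partition of unity (3.36)–(3.37) p. 660, the vacuum energy counterterm `E₁` «represented by
a sum of vacuum energy diagrams» p. 659 (3.35), Proposition 3.6 (3.56) p. 662 — KING's OWN `A = 0` MODEL on the rung's tori (`T_η = Tor (fine (L^K) (kingVol L jv))`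
over the unit torus `T^{(K)} = Tor (kingVol L jv)`, `|T^{(K)}| = (2L^{jv.m})^{d+1}`).  NOT Bałaban's `G(U)`; NOT a node discharge (N15 is booked through n15-a's
knit, untouched here); nothing continuum ∕ ℝ⁴ ∕ OS ∕ mass-gap ∕ Clay.  0 `sorry`; standard axioms.  Text layer of pp. 655–662 (`paper:king1986-cmp102-king-u1-higgs-i`
p0007–p0014) re-read by this seat 2026-08-29.  The field-paired form ((3.40)–(3.42)) and the hypothesis-free class follow in part Β-b (`…GraphTreeDecayExtensiveFields`).

THE PRINT.  p. 656 [PDF 8], Theorem 3.4 (3.9): *«|S^{(k),1}(T^{(k)}, A_k, φ_k, g, h) − S^{(k+n),1}(T^{(k)}, A_k, φ_k, g, h)| ≤ C(L^{−γk}(L^kε_κ)^{−β} + (L^kε_κ)^σ)|T|»*;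
p. 660 [PDF 12] (3.36)–(3.37): *«Σ_{z∈T^{(k)}} χ_z(x) = 1, each x ∈ T_η. By inserting (3.36) at each internal vertex of H, we can rewrite (3.29) as …»*; p. 659
[PDF 11]: *«Clearly E₁ is represented by a sum of vacuum energy diagrams on T_η»*; p. 662 (3.56).

READING (declared; ours).  (1) THE GRAPH VALUE IS LINEAR IN EACH ONE-VERTEX FACTOR (§1, generic): `E(…, u[υ ↦ Σ_i h_i]) = Σ_i E(…, u[υ ↦ h_i])`.  (2) THE
LATTICE PARTITION OF UNITY (§2): the indicators `χ_b(x) = [B(x) = b]` of the unit blocks `b ∈ T^{(K)}` sum to `1` on `T_η`, and — read through King's pairing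
`x′ ↦ x` — on `T_{η′}`; as one-vertex factors they are ANCHORED at the base point `y_b` (`χ_b(x) ≤ e^{δ′}·χ_b(x)·e^{−δ′|x − y_b|}`, since `|x − y_b| ≤ 1` on the
block), have `L¹` norm `Σ_x η^{d+1}·e^{δ′}χ_b(x) = e^{δ′}` (a unit block has `L^{K(d+1)}` fine points) INDEPENDENT OF THE VOLUME, and two-spacing rate ZERO
(`χ_b(x′) := χ_b(x)`).  (3) VACUUM DIAGRAMS (§3): a leg-free connected graph `E^{(θ)}(G) = Σ_{x_0,…,x_nn} η^{(d+1)(nn+1)} Π_ℓ G_ℓ` (written with one trivial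
factor `1` at the vertex `0`) is, by (1)–(2), the sum over `b ∈ T^{(K)}` of the same graph with `χ_b` at the vertex `0`; part Α-f's
`king_prop36_graph_zeroField_treeDecay_subgraphs` bounds each pinned two-spacing difference by `e·C₁^m C₂^{nn}·(m!·g^m)·L^{−γK}(m+1)` uniformly in `b` and in
the volume ⇒ ★★★ `|E^{(K+n)}(G) − E^{(K)}(G)| ≤ |T^{(K)}|·L^{−γK}·A^{2m+nn+1}·m!·(m+1)` — (3.9)'s `C L^{−γk}|T|` for ONE vacuum diagram; the size form (part Α-f
`king_graph_size_treeDecay_kruskal`) gives ★★ `|E^{(K)}(G)| ≤ |T^{(K)}|·A^{m+nn+1}·(Σ_π degConst)` uniformly in `K` — UV-finite AND extensive, the shape of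
Theorem 2.1 (ii)'s `C|T|` for one diagram.

WHAT THIS FILE PROVES.  §1 (namespace `…N15KingModelRung.Graph`): `graphValLS_update_eq`, ★ `graphValLS_update_sum`, `graphValLS_update_add`,
★ `graphValLS_unit_sum`.  §2 (namespace `…Curved`): `blockIndLo`∕`blockIndHi`, `sum_blockIndLo_eq_one`∕`sum_blockIndHi_eq_one` ((3.36) on both lattices),
`kingDist_basePt_le_one_of_blockOf`, ★ `blockIndLo_le_anchored` (anchored size), ★ `sum_weight_blockIndLo` (`L¹` norm, volume-free), `card_unitTorus`
(`|T^{(K)}| = (2L^{m})^{d+1}`, (3.15)).  §3 ★★★ **`king_vacuum_graph_rate_extensive`**, ★★ **`king_vacuum_graph_size_extensive`**.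

HONEST SCOPE.  (a) King's `A = 0` model: lines carry `G^η_K`∕`∂^η_μG^η_K` (kinds `κ`); the vertices (3.18)–(3.26) with their couplings `(L^kε)^{…}`, the sources
`g, h`, the dressings (3.46) and §3.5's renormalised combinations are NOT placed — so the `(L^kε_κ)^{−β}`, `(L^kε_κ)^σ` bookkeeping of (3.9) and the near∕far
split (3.41) have no counterpart here (the model's unit lattice IS the final lattice); what is typed is the MECHANISM «partition of unity at a vertex ⇒ sum over
`T^{(k)}` of volume-uniform pinned bounds ⇒ `|T|`».  (b) p. 664's sentence is the hypothesis of the rate form, (3.77) along every ordering that of the size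
form (both discharged for the pseudoforest class in part Β-b).  (c) NOT Bałaban's `G(U)`; N15 untouched; counts unmoved.
Locators: [King1986] Thm 2.1 (ii) (2.23) p.654, Thm 3.4 (3.9) p.656, (3.15) p.657, (3.35) p.659, (3.36)–(3.37) p.660, Prop. 3.6 (3.56) p.662, p.664, (3.77) p.666.
-/

noncomputable section

open scoped BigOperators
open Finset

/-! ## §1 The graph value is linear in each one-vertex factor (generic) -/

namespace Summit.QuantumFields.YangMills.BalabanUVNodes.N15KingModelRung.Graph

section Linear

variable {V Λ Υ T : Type*} [Fintype V] [DecidableEq V] [Fintype Λ] [Fintype Υ] [DecidableEq Υ] [Fintype T]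
  {𝕂 : Type*} [CommSemiring 𝕂]

/-- The graph value with the one-vertex factor `υ` replaced by `h`, that factor pulled out of the product. [cite: King1986, (3.37) p.660 («inserting (3.36) at each
internal vertex»)] -/
theorem graphValLS_update_eq (w : 𝕂) (src tgt : Λ → V) (G : Λ → T → T → 𝕂) (vtx : Υ → V) (u : Υ → T → 𝕂) (υ : Υ) (h : T → 𝕂) :
    graphValLS w src tgt G vtx (Function.update u υ h)
      = ∑ σ : V → T, w ^ Fintype.card V * ((∏ ℓ, G ℓ (σ (src ℓ)) (σ (tgt ℓ)))
          * (h (σ (vtx υ)) * ∏ υ' ∈ univ.erase υ, u υ' (σ (vtx υ')))) := by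
  unfold graphValLS
  refine sum_congr rfl fun σ _ => ?_
  congr 2
  rw [← mul_prod_erase univ (fun υ' => Function.update u υ h υ' (σ (vtx υ'))) (mem_univ υ), Function.update_self]
  congr 1
  exact prod_congr rfl fun υ' hυ' => by rw [Function.update_of_ne (ne_of_mem_erase hυ')]

/-- ★ **LINEARITY IN A ONE-VERTEX FACTOR (finite sums)**: `E(…, u[υ ↦ Σ_{i∈s} h_i]) = Σ_{i∈s} E(…, u[υ ↦ h_i])` — the identity behind (3.37) (a partition of
unity inserted at a vertex splits the graph into a sum of graphs). [cite: King1986, (3.36)–(3.37) p.660] -/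
theorem graphValLS_update_sum (w : 𝕂) (src tgt : Λ → V) (G : Λ → T → T → 𝕂) (vtx : Υ → V) (u : Υ → T → 𝕂) (υ : Υ)
    {ι : Type*} (s : Finset ι) (h : ι → T → 𝕂) :
    graphValLS w src tgt G vtx (Function.update u υ (fun x => ∑ i ∈ s, h i x))
      = ∑ i ∈ s, graphValLS w src tgt G vtx (Function.update u υ (h i)) := by
  simp only [graphValLS_update_eq, sum_mul, mul_sum]
  exact sum_comm

/-- Linearity in a one-vertex factor (two summands). [cite: King1986, (3.36)–(3.37) p.660] -/
theorem graphValLS_update_add (w : 𝕂) (src tgt : Λ → V) (G : Λ → T → T → 𝕂) (vtx : Υ → V) (u : Υ → T → 𝕂) (υ : Υ) (f g : T → 𝕂) :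
    graphValLS w src tgt G vtx (Function.update u υ (fun x => f x + g x))
      = graphValLS w src tgt G vtx (Function.update u υ f) + graphValLS w src tgt G vtx (Function.update u υ g) := by
  simp only [graphValLS_update_eq, add_mul, mul_add, sum_add_distrib]

omit [Fintype Υ] [DecidableEq Υ] in
/-- ★ **ONE FACTOR ONLY** (`Υ = Unit`, the factor at the vertex `v`): `E(…, Σ_{i∈s} h_i at v) = Σ_{i∈s} E(…, h_i at v)`. [cite: King1986, (3.36)–(3.37) p.660] -/
theorem graphValLS_unit_sum (w : 𝕂) (src tgt : Λ → V) (G : Λ → T → T → 𝕂) (v : V) {ι : Type*} (s : Finset ι) (h : ι → T → 𝕂) :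
    graphValLS w src tgt G (fun _ : Unit => v) (fun _ x => ∑ i ∈ s, h i x)
      = ∑ i ∈ s, graphValLS w src tgt G (fun _ : Unit => v) (fun _ => h i) := by
  have hupd : ∀ f : T → 𝕂, (fun _ : Unit => f) = Function.update (fun _ : Unit => f) () f := fun f => by
    funext υ; cases υ; rw [Function.update_self]
  have key := graphValLS_update_sum w src tgt G (fun _ : Unit => v) (fun (_ : Unit) (x : T) => ∑ i ∈ s, h i x) () s h
  rw [← hupd] at key
  refine key.trans (sum_congr rfl fun i _ => ?_)
  rw [show Function.update (fun (_ : Unit) (x : T) => ∑ i ∈ s, h i x) () (h i) = fun _ => h i from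
    funext fun υ => by cases υ; rw [Function.update_self]]

end Linear

end Summit.QuantumFields.YangMills.BalabanUVNodes.N15KingModelRung.Graph

namespace Summit.QuantumFields.YangMills.BalabanUVNodes.N15KingModelRung.Curved

open Literature.MathematicalPhysics.QuantumFieldTheory.Balaban1983to89.B4Sect5Proof (latticeConst latticeConst_nonneg)
open Literature.MathematicalPhysics.QuantumFieldTheory.Balaban1983to89.B5Prop11Plancherel (Tor fine)
open Literature.MathematicalPhysics.QuantumFieldTheory.King1986.Torus (tdistT tdistT_nonneg tdistT_self blockOf)
open Summit.QuantumFields.YangMills.BalabanUVNodes.N15KingModelRung (KingVolIndex kingVol kingVol_neZero basePt blockOf_basePt)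
open Summit.QuantumFields.YangMills.BalabanUVNodes.N15KingModelRung.Graph

variable {d : ℕ} (L : ℕ) [NeZero L]

/-! ## §2 The lattice partition of unity (3.36): block indicators as anchored one-vertex factors of two-spacing rate zero -/

section PartitionOfUnity

/-- **THE INDICATOR OF THE UNIT BLOCK `b₀ ∈ T^{(K)}` ON `T_η`**: `χ_{b₀}(x) = [B(x) = b₀]` — the lattice form of King's partition of unity `χ_z`, (3.36).
[cite: King1986, (3.36) p.660] -/
def blockIndLo (jv : KingVolIndex d) (b₀ : Tor (kingVol L jv)) (x : haveI := kingVol_neZero L jv; Tor (fine (L ^ jv.K) (kingVol L jv))) : ℝ :=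
  haveI := kingVol_neZero L jv
  if blockOf (L ^ jv.K) (kingVol L jv) x = b₀ then 1 else 0

/-- **THE SAME INDICATOR READ ON `T_{η′}` THROUGH KING's PAIRING** `x′ ↦ x` (p. 664): `χ_{b₀}(x′) := χ_{b₀}(x)` — so its two-spacing difference is ZERO.
[cite: King1986, (3.36) p.660, p.664 (pairing)] -/
def blockIndHi (jv : KingVolIndex d) (n : ℕ) (b₀ : Tor (kingVol L jv))
    (x' : haveI := kingVol_neZero L jv; Tor (fine (L ^ (jv.K + n)) (kingVol L jv))) : ℝ :=
  haveI := kingVol_neZero L jv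
  blockIndLo L jv b₀ (kingSlicePt L jv.K n (kingVol L jv) x')

/-- `0 ≤ χ_{b₀}(x)`. [cite: King1986, (3.36) p.660] -/
theorem blockIndLo_nonneg (jv : KingVolIndex d) (b₀ : Tor (kingVol L jv)) (x : haveI := kingVol_neZero L jv; Tor (fine (L ^ jv.K) (kingVol L jv))) :
    0 ≤ blockIndLo L jv b₀ x := by
  unfold blockIndLo
  split_ifs <;> norm_num

/-- `χ_{b₀}(x) ≤ 1`. [cite: King1986, (3.36) p.660] -/
theorem blockIndLo_le_one (jv : KingVolIndex d) (b₀ : Tor (kingVol L jv)) (x : haveI := kingVol_neZero L jv; Tor (fine (L ^ jv.K) (kingVol L jv))) :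
    blockIndLo L jv b₀ x ≤ 1 := by
  unfold blockIndLo
  split_ifs <;> norm_num

/-- **(3.36) ON `T_η`**: `Σ_{b₀ ∈ T^{(K)}} χ_{b₀}(x) = 1`. [cite: King1986, (3.36) p.660] -/
theorem sum_blockIndLo_eq_one (jv : KingVolIndex d) (x : haveI := kingVol_neZero L jv; Tor (fine (L ^ jv.K) (kingVol L jv))) :
    haveI := kingVol_neZero L jv
    ∑ b₀ : Tor (kingVol L jv), blockIndLo L jv b₀ x = 1 := by
  haveI := kingVol_neZero L jv
  simp only [blockIndLo]
  rw [Finset.sum_ite_eq univ (blockOf (L ^ jv.K) (kingVol L jv) x) (fun _ => (1 : ℝ)), if_pos (mem_univ _)]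

/-- **(3.36) ON `T_{η′}`** (through the pairing): `Σ_{b₀} χ_{b₀}(x′) = 1`. [cite: King1986, (3.36) p.660, p.664] -/
theorem sum_blockIndHi_eq_one (jv : KingVolIndex d) (n : ℕ) (x' : haveI := kingVol_neZero L jv; Tor (fine (L ^ (jv.K + n)) (kingVol L jv))) :
    haveI := kingVol_neZero L jv
    ∑ b₀ : Tor (kingVol L jv), blockIndHi L jv n b₀ x' = 1 := by
  haveI := kingVol_neZero L jv
  simp only [blockIndHi]
  exact sum_blockIndLo_eq_one L jv _

/-- **A POINT OF A UNIT BLOCK IS WITHIN UNIT-BLOCK DISTANCE `1` OF THE BLOCK's BASE POINT**: `B(x) = b₀ ⇒ |x − y_{b₀}| ≤ 1` (`|x − y| = tdistT∕L^K`;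
`tdistT ≤ L^K·|B(x) − B(y)|_T + L^K − 1`). [cite: King1986, p.664 (pairing convention), (3.36) p.660] -/
theorem kingDist_basePt_le_one_of_blockOf (hL : 1 ≤ L) (jv : KingVolIndex d) {b₀ : Tor (kingVol L jv)}
    {x : haveI := kingVol_neZero L jv; Tor (fine (L ^ jv.K) (kingVol L jv))}
    (hx : haveI := kingVol_neZero L jv; blockOf (L ^ jv.K) (kingVol L jv) x = b₀) :
    haveI := kingVol_neZero L jv
    kingDist L jv x (basePt (L ^ jv.K) (kingVol L jv) b₀) ≤ 1 := by
  haveI := kingVol_neZero L jv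
  have hL0 : (0 : ℝ) < L := by exact_mod_cast (show 0 < L by omega)
  have hN : (0 : ℝ) < (L : ℝ) ^ jv.K := pow_pos hL0 _
  have h := tdistT_fine_le_blocks (L ^ jv.K) (kingVol L jv) x (basePt (L ^ jv.K) (kingVol L jv) b₀)
  rw [blockOf_basePt, hx, tdistT_self] at h
  push_cast at h
  unfold kingDist
  rw [div_le_one hN]
  linarith

/-- ★ **THE INDICATOR IS AN ANCHORED ONE-VERTEX FACTOR**: `χ_{b₀}(x) ≤ (e^{δ′}·χ_{b₀}(x))·legWeight δ′ |·| (some y_{b₀}) x` for `δ′ ≥ 0` — majorant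
`p₀ = e^{δ′}χ_{b₀}`, anchor `y_{b₀}`, leg rate `δ′` (part Α-f's hypothesis shape). [cite: King1986, (3.36) p.660, p.664] -/
theorem blockIndLo_le_anchored (hL : 1 ≤ L) (jv : KingVolIndex d) {δ' : ℝ} (hδ' : 0 ≤ δ') (b₀ : Tor (kingVol L jv))
    (x : haveI := kingVol_neZero L jv; Tor (fine (L ^ jv.K) (kingVol L jv))) :
    haveI := kingVol_neZero L jv
    |blockIndLo L jv b₀ x| ≤ (Real.exp δ' * blockIndLo L jv b₀ x) * legWeight δ' (kingDist L jv) (some (basePt (L ^ jv.K) (kingVol L jv) b₀)) x := by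
  haveI := kingVol_neZero L jv
  rw [abs_of_nonneg (blockIndLo_nonneg L jv b₀ x)]
  have hw : legWeight δ' (kingDist L jv) (some (basePt (L ^ jv.K) (kingVol L jv) b₀)) x
      = Real.exp (-(δ' * kingDist L jv x (basePt (L ^ jv.K) (kingVol L jv) b₀))) := rfl
  rw [hw]
  by_cases hx : blockOf (L ^ jv.K) (kingVol L jv) x = b₀
  · have h1 := kingDist_basePt_le_one_of_blockOf L hL jv hx
    have hval : blockIndLo L jv b₀ x = 1 := by simp only [blockIndLo, if_pos hx]
    rw [hval, mul_one, ← Real.exp_add]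
    exact Real.one_le_exp (by nlinarith)
  · have hval : blockIndLo L jv b₀ x = 0 := by simp only [blockIndLo, if_neg hx]
    rw [hval]
    simp

/-- ★ **THE `L¹` NORM OF THE INDICATOR's MAJORANT IS VOLUME-FREE**: `Σ_{x ∈ T_η} η^{d+1}·(e^{δ′}χ_{b₀}(x)) = e^{δ′}` — a unit block has `L^{K(d+1)}` points of
`T_η` (`sum_fine_blockOf`). [cite: King1986, (3.36) p.660, (3.68) p.664] -/
theorem sum_weight_blockIndLo (jv : KingVolIndex d) (c : ℝ) (b₀ : Tor (kingVol L jv)) :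
    haveI := kingVol_neZero L jv
    ∑ x : Tor (fine (L ^ jv.K) (kingVol L jv)), (((L : ℝ) ^ jv.K)⁻¹) ^ (d + 1) * (c * blockIndLo L jv b₀ x) = c := by
  haveI := kingVol_neZero L jv
  have hN : ((L : ℝ) ^ jv.K) ^ (d + 1) ≠ 0 := pow_ne_zero _ (pow_ne_zero _ (Nat.cast_ne_zero.2 (NeZero.ne L)))
  rw [← mul_sum, ← mul_sum]
  have h := sum_fine_blockOf (L ^ jv.K) (kingVol L jv) (fun b => if b = b₀ then (1 : ℝ) else 0)
  simp only [blockIndLo]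
  rw [h, Finset.sum_ite_eq' univ b₀ (fun _ => (1 : ℝ)), if_pos (mem_univ _), mul_one]
  push_cast
  rw [inv_pow, ← mul_assoc, mul_comm _ c, mul_assoc, inv_mul_cancel₀ hN, mul_one]

/-- **`|T^{(K)}| = (2L^{m})^{d+1}`** — the number of unit-lattice sites of the rung's torus (King's `|T^{(k)}| = |T| = Π_μ 2L_μ`, (3.15)). [cite: King1986, (3.15) p.657] -/
theorem card_unitTorus (jv : KingVolIndex d) : haveI := kingVol_neZero L jv; Fintype.card (Tor (kingVol L jv)) = (2 * L ^ jv.m) ^ (d + 1) := by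
  haveI := kingVol_neZero L jv
  simp only [Fintype.card_pi, ZMod.card, kingVol, prod_const, card_univ, Fintype.card_fin]

end PartitionOfUnity

/-! ## §3 Vacuum diagrams: `|E^{(K+n)}(G) − E^{(K)}(G)| ≤ |T^{(K)}|·C_G·L^{−γK}` and `|E^{(K)}(G)| ≤ |T^{(K)}|·C_G` -/

section Vacuum

/-- ★★★ **VACUUM DIAGRAMS CONVERGE AT THE RATE `L^{−γK}`, EXTENSIVELY — THE SHAPE `C L^{−γk}|T|` OF THEOREM 3.4 (3.9) FOR ONE DIAGRAM, BY NAME AT `A = 0`.**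
For odd `L ≥ 3`, `a > 0`, `m₀² ≥ 0` there are `A ≥ 1`, `γ > 0` such that for every mass `0 < m² ≤ m₀²`, index `jv`, `n ≥ 1` and every CONNECTED numbered graph
(`nn + 1` vertices, `m` lines of kinds `κ` carrying `G^η_K`∕`∂^η_μG^η_K`, no external legs) satisfying p. 664's sentence:
`|Σ_{x′} η′^{(d+1)(nn+1)}Π_ℓ G^{η′}_ℓ − Σ_{x} η^{(d+1)(nn+1)}Π_ℓ G^η_ℓ| ≤ |T^{(K)}|·L^{−γK}·A^{2m+nn+1}·m!·(m+1)` — the partition of unity (3.36) at the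
vertex `0` (§1–§2) and part Α-f's `king_prop36_graph_zeroField_treeDecay_subgraphs` at each block, whose bound is uniform in the block and in the volume.
(The leg-free amplitude is written with one trivial factor `1` at the vertex `0`.) [cite: King1986, Thm 3.4 (3.9) p.656, (3.35) p.659 («E₁ is represented by a
sum of vacuum energy diagrams»), (3.36)–(3.37) p.660, Prop. 3.6 (3.56) p.662, p.664] -/
theorem king_vacuum_graph_rate_extensive (hLodd : Odd L) (hL : 2 ≤ L) {a : ℝ} (ha : 0 < a) {m0sq : ℝ} (hm0 : 0 ≤ m0sq) :
    ∃ A γ : ℝ, 1 ≤ A ∧ 0 < γ ∧ ∀ (msq : ℝ), 0 < msq → msq ≤ m0sq → ∀ (jv : KingVolIndex d) (n : ℕ), 1 ≤ n →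
      ∀ (nn m : ℕ) (src tgt : Fin m → Fin (nn + 1)), (∀ v, LConn src tgt univ 0 v) →
      ∀ (κ : Fin m → Option (Fin (d + 1))), PosSubgraphsBy src tgt 0 ((d + 1 : ℕ) : ℝ) (fun ℓ => lineExp (d + 1) (κ ℓ)) →
        haveI := kingVol_neZero L jv
        |graphValLS ((((L : ℝ) ^ (jv.K + n))⁻¹) ^ (d + 1)) src tgt (fun ℓ => kingGLine L (kingVol L jv) a msq (jv.K + n) (κ ℓ))
              (fun _ : Unit => (0 : Fin (nn + 1))) (fun _ _ => (1 : ℝ))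
            - graphValLS ((((L : ℝ) ^ jv.K)⁻¹) ^ (d + 1)) src tgt (fun ℓ => kingGLine L (kingVol L jv) a msq jv.K (κ ℓ))
              (fun _ : Unit => (0 : Fin (nn + 1))) (fun _ _ => (1 : ℝ))|
          ≤ (Fintype.card (Tor (kingVol L jv)) : ℝ) * (L : ℝ) ^ (-(γ * jv.K)) * (A ^ (2 * m + nn + 1) * ((m.factorial : ℝ) * (m + 1))) := by
  obtain ⟨C₁, C₂, γ₀, δ₁, hC₁, hC₂, hγ₀, hδ₁, H⟩ := king_prop36_graph_zeroField_treeDecay_subgraphs (d := d) L hLodd hL ha hm0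
  have hL1 : 1 ≤ L := by omega
  have hL1r : (1 : ℝ) < L := by exact_mod_cast (show 1 < L by omega)
  set g : ℝ := (1 - (L : ℝ) ^ (-(1 / 4 : ℝ)))⁻¹ with hgdef
  have hq1 : (L : ℝ) ^ (-(1 / 4 : ℝ)) < 1 := Real.rpow_lt_one_of_one_lt_of_neg hL1r (by norm_num)
  have hq0 : 0 < (L : ℝ) ^ (-(1 / 4 : ℝ)) := Real.rpow_pos_of_pos (by linarith) _
  have hg1 : 1 ≤ g := by rw [hgdef]; exact (one_le_inv₀ (by linarith)).2 (by linarith)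
  set e1 : ℝ := Real.exp 1 with he1def
  have he1 : 1 ≤ e1 := Real.one_le_exp (by norm_num)
  set A : ℝ := e1 + C₁ + C₂ + g with hA
  have hA1 : 1 ≤ A := by rw [hA]; linarith
  have hA0 : 0 ≤ A := zero_le_one.trans hA1
  have hC₁A : C₁ ≤ A := by rw [hA]; linarith
  have hC₂A : C₂ ≤ A := by rw [hA]; linarith
  have hgA : g ≤ A := by rw [hA]; linarith
  have heA : e1 ≤ A := by rw [hA]; linarith
  refine ⟨A, min γ₀ (1 / 4), hA1, lt_min hγ₀ (by norm_num), fun msq hm hcap jv n hn nn m src tgt hconn κ hsub => ?_⟩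
  haveI := kingVol_neZero L jv
  set θ : ℝ := (L : ℝ) ^ (-(min γ₀ (1 / 4) * jv.K)) with hθ
  have hθ0 : 0 ≤ θ := Real.rpow_nonneg (by linarith) _
  -- the pinned differences, block by block
  have hpin : ∀ b₀ : Tor (kingVol L jv),
      |graphValLS ((((L : ℝ) ^ (jv.K + n))⁻¹) ^ (d + 1)) src tgt (fun ℓ => kingGLine L (kingVol L jv) a msq (jv.K + n) (κ ℓ))
            (fun _ : Unit => (0 : Fin (nn + 1))) (fun _ => blockIndHi L jv n b₀)
          - graphValLS ((((L : ℝ) ^ jv.K)⁻¹) ^ (d + 1)) src tgt (fun ℓ => kingGLine L (kingVol L jv) a msq jv.K (κ ℓ))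
            (fun _ : Unit => (0 : Fin (nn + 1))) (fun _ => blockIndLo L jv b₀)|
        ≤ θ * (A ^ (2 * m + nn + 1) * ((m.factorial : ℝ) * (m + 1))) := by
    intro b₀
    have key := H msq hm hcap jv n hn nn m src tgt hconn κ hsub Unit (fun _ => 0) () rfl
      (fun _ => some (basePt (L ^ jv.K) (kingVol L jv) b₀)) 1 zero_le_one
      (fun _ => blockIndLo L jv b₀) (fun _ => blockIndHi L jv n b₀) (fun _ => 0) (fun _ => 0)
      (fun x => Real.exp 1 * blockIndLo L jv b₀ x) (fun _ => 0) (Real.exp 1) 0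
      (fun _ => le_rfl) (fun _ => le_rfl) (fun x => mul_nonneg (Real.exp_nonneg _) (blockIndLo_nonneg L jv b₀ x)) (fun _ => le_rfl)
      (fun υ hυ => absurd (Subsingleton.elim υ ()) hυ) (fun υ hυ => absurd (Subsingleton.elim υ ()) hυ)
      (fun υ hυ => absurd (Subsingleton.elim υ ()) hυ)
      (fun x => blockIndLo_le_anchored L hL1 jv zero_le_one b₀ x)
      (fun x' => blockIndLo_le_anchored L hL1 jv zero_le_one b₀ _)
      (fun x' => by simp only [blockIndHi, sub_self, abs_zero, zero_mul]; exact le_rfl)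
      (le_of_eq (sum_weight_blockIndLo L jv (Real.exp 1) b₀)) (by simp)
    refine key.trans ?_
    -- simplify the right-hand side: one anchor ⇒ tree length 0; `Υ ∖ {υ₀} = ∅`
    have htree : treeLength (kingDist L jv) (anchors fun _ : Unit => some (basePt (L ^ jv.K) (kingVol L jv) b₀)) = 0 := by
      refine treeLength_of_card_le_one (fun x y => kingDist_nonneg L jv x y) ?_
      refine (card_le_one_iff_subset_singleton.2 ⟨basePt (L ^ jv.K) (kingVol L jv) b₀, fun y hy => ?_⟩)
      obtain ⟨υ, hυ⟩ := (mem_anchors _).1 hy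
      exact mem_singleton.2 (Option.some_injective _ hυ.symm)
    have herase : (univ : Finset Unit).erase () = ∅ := by
      rw [Fintype.univ_ofSubsingleton (), erase_singleton]   -- `univ = {()}` for Unit
    rw [htree, mul_zero, neg_zero, Real.exp_zero, one_mul, herase, sum_empty, prod_empty, add_zero, zero_add, mul_one]
    -- e·(θ(m+1))·(C₁^m C₂^nn (m! g^m)) ≤ θ·A^{2m+nn+1}·m!·(m+1)
    have hP : C₁ ^ m * C₂ ^ nn * ((m.factorial : ℝ) * g ^ m) ≤ (m.factorial : ℝ) * A ^ (2 * m + nn) := by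
      have e : (m.factorial : ℝ) * A ^ (2 * m + nn) = A ^ m * A ^ nn * ((m.factorial : ℝ) * A ^ m) := by
        rw [show 2 * m + nn = m + nn + m by omega, pow_add, pow_add]; ring
      rw [e]
      exact mul_le_mul (mul_le_mul (pow_le_pow_left₀ hC₁.le hC₁A m) (pow_le_pow_left₀ hC₂.le hC₂A nn) (pow_nonneg hC₂.le _) (pow_nonneg hA0 _))
        (mul_le_mul_of_nonneg_left (pow_le_pow_left₀ (zero_le_one.trans hg1) hgA m) (Nat.cast_nonneg _)) (by positivity) (by positivity)
    calc Real.exp 1 * (θ * ((m : ℝ) + 1)) * (C₁ ^ m * C₂ ^ nn * ((m.factorial : ℝ) * g ^ m))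
        ≤ A * (θ * ((m : ℝ) + 1)) * ((m.factorial : ℝ) * A ^ (2 * m + nn)) :=
          mul_le_mul (mul_le_mul_of_nonneg_right heA (by positivity)) hP (by positivity) (by positivity)
      _ = θ * (A ^ (2 * m + nn + 1) * ((m.factorial : ℝ) * (m + 1))) := by rw [pow_succ]; ring
  -- the partition of unity at the root, coarse and fine (§1–§2)
  have hLo : graphValLS ((((L : ℝ) ^ jv.K)⁻¹) ^ (d + 1)) src tgt (fun ℓ => kingGLine L (kingVol L jv) a msq jv.K (κ ℓ))
        (fun _ : Unit => (0 : Fin (nn + 1))) (fun _ _ => (1 : ℝ))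
      = ∑ b₀ : Tor (kingVol L jv), graphValLS ((((L : ℝ) ^ jv.K)⁻¹) ^ (d + 1)) src tgt (fun ℓ => kingGLine L (kingVol L jv) a msq jv.K (κ ℓ))
        (fun _ : Unit => (0 : Fin (nn + 1))) (fun _ => blockIndLo L jv b₀) := by
    have h1 : (fun (_ : Unit) (_ : Tor (fine (L ^ jv.K) (kingVol L jv))) => (1 : ℝ))
        = fun _ x => ∑ b₀ : Tor (kingVol L jv), blockIndLo L jv b₀ x := by
      funext υ x; rw [sum_blockIndLo_eq_one]
    rw [h1, graphValLS_unit_sum]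
  have hHi : graphValLS ((((L : ℝ) ^ (jv.K + n))⁻¹) ^ (d + 1)) src tgt (fun ℓ => kingGLine L (kingVol L jv) a msq (jv.K + n) (κ ℓ))
        (fun _ : Unit => (0 : Fin (nn + 1))) (fun _ _ => (1 : ℝ))
      = ∑ b₀ : Tor (kingVol L jv), graphValLS ((((L : ℝ) ^ (jv.K + n))⁻¹) ^ (d + 1)) src tgt
          (fun ℓ => kingGLine L (kingVol L jv) a msq (jv.K + n) (κ ℓ)) (fun _ : Unit => (0 : Fin (nn + 1))) (fun _ => blockIndHi L jv n b₀) := by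
    have h1 : (fun (_ : Unit) (_ : Tor (fine (L ^ (jv.K + n)) (kingVol L jv))) => (1 : ℝ))
        = fun _ x' => ∑ b₀ : Tor (kingVol L jv), blockIndHi L jv n b₀ x' := by
      funext υ x'; rw [sum_blockIndHi_eq_one]
    rw [h1, graphValLS_unit_sum]
  rw [hLo, hHi, ← sum_sub_distrib]
  refine (abs_sum_le_sum_abs _ _).trans ((sum_le_sum fun b₀ _ => hpin b₀).trans ?_)
  rw [sum_const, card_univ, nsmul_eq_mul]
  rw [mul_assoc]

/-- ★★ **VACUUM DIAGRAMS ARE UV-FINITE UNIFORMLY IN `K` AND EXTENSIVE — `|E^{(K)}(G)| ≤ |T^{(K)}|·A^{2m+nn+1}·(Σ_π degConst)`** (the shape of Theorem 2.1 (ii)'s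
`|ln Z| ≤ C|T|` for one diagram): for odd `L ≥ 3`, `a > 0`, `m₀² ≥ 0` there is `A ≥ 1` such that for every mass, index `jv`, every CONNECTED numbered graph with
King's degrees positive along every ordering ((3.77)): `|E^{(K)}(G)| ≤ |T^{(K)}|·A^{m+nn+1}·(Σ_π degConst L (kingDegList …))` — the partition of unity at the
vertex `0` and part Α-f's `king_graph_size_treeDecay_kruskal` at each block (volume-uniform). [cite: King1986, Thm 2.1 (ii) (2.23) p.654, Thm 3.5 (3.38) p.660,
(3.35) p.659, (3.36)–(3.37) p.660, (3.77) p.666] -/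
theorem king_vacuum_graph_size_extensive (hLodd : Odd L) (hL : 2 ≤ L) {a : ℝ} (ha : 0 < a) {m0sq : ℝ} (hm0 : 0 ≤ m0sq) :
    ∃ A : ℝ, 1 ≤ A ∧ ∀ (msq : ℝ), 0 < msq → msq ≤ m0sq → ∀ (jv : KingVolIndex d)
      (nn m : ℕ) (src tgt : Fin m → Fin (nn + 1)), (∀ v, LConn src tgt univ 0 v) → ∀ (κ : Fin m → Option (Fin (d + 1))),
      (∀ π : Equiv.Perm (Fin m), PosDegrees (kingDegList src tgt ((d + 1 : ℕ) : ℝ) (fun ℓ => lineExp (d + 1) (κ ℓ)) π)) →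
        haveI := kingVol_neZero L jv
        |graphValLS ((((L : ℝ) ^ jv.K)⁻¹) ^ (d + 1)) src tgt (fun ℓ => kingGLine L (kingVol L jv) a msq jv.K (κ ℓ))
              (fun _ : Unit => (0 : Fin (nn + 1))) (fun _ _ => (1 : ℝ))|
          ≤ (Fintype.card (Tor (kingVol L jv)) : ℝ) * (A ^ (m + nn + 1)
              * ∑ π : Equiv.Perm (Fin m), degConst L (kingDegList src tgt ((d + 1 : ℕ) : ℝ) (fun ℓ => lineExp (d + 1) (κ ℓ)) π)) := by
  classical
  obtain ⟨C₁, C₂, δ₁, hC₁, hC₂, hδ₁, H⟩ := king_graph_size_treeDecay_kruskal (d := d) L hLodd hL ha hm0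
  have hL1 : 1 ≤ L := by omega
  set e1 : ℝ := Real.exp 1 with he1def
  have he1 : 1 ≤ e1 := Real.one_le_exp (by norm_num)
  set A : ℝ := e1 + C₁ + C₂ with hA
  have hA1 : 1 ≤ A := by rw [hA]; linarith
  have hA0 : 0 ≤ A := zero_le_one.trans hA1
  have hC₁A : C₁ ≤ A := by rw [hA]; linarith
  have hC₂A : C₂ ≤ A := by rw [hA]; linarith
  have heA : e1 ≤ A := by rw [hA]; linarith
  refine ⟨A, hA1, fun msq hm hcap jv nn m src tgt hconn κ hking => ?_⟩
  haveI := kingVol_neZero L jv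
  set D : ℝ := ∑ π : Equiv.Perm (Fin m), degConst L (kingDegList src tgt ((d + 1 : ℕ) : ℝ) (fun ℓ => lineExp (d + 1) (κ ℓ)) π) with hD
  have hD0 : 0 ≤ D := sum_nonneg fun π _ => zero_le_one.trans (one_le_degConst L hL (hking π))
  have hpin : ∀ b₀ : Tor (kingVol L jv),
      |graphValLS ((((L : ℝ) ^ jv.K)⁻¹) ^ (d + 1)) src tgt (fun ℓ => kingGLine L (kingVol L jv) a msq jv.K (κ ℓ))
          (fun _ : Unit => (0 : Fin (nn + 1))) (fun _ => blockIndLo L jv b₀)| ≤ A ^ (m + nn + 1) * D := by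
    intro b₀
    have key := H jv.K jv.m jv.one_le_K (kingVol L jv) (fun _ => rfl) msq hm hcap nn m src tgt hconn κ Unit (fun _ => 0) () rfl
      (fun _ => some (basePt (L ^ jv.K) (kingVol L jv) b₀)) 1 zero_le_one (fun _ => blockIndLo L jv b₀) (fun _ => 0)
      (fun x => Real.exp 1 * blockIndLo L jv b₀ x) (Real.exp 1) (fun _ => le_rfl)
      (fun x => mul_nonneg (Real.exp_nonneg _) (blockIndLo_nonneg L jv b₀ x))
      (fun υ hυ => absurd (Subsingleton.elim υ ()) hυ)
      (fun x => blockIndLo_le_anchored L hL1 jv zero_le_one b₀ x)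
      (le_of_eq (sum_weight_blockIndLo L jv (Real.exp 1) b₀)) hking
    refine key.trans ?_
    have herase : (univ : Finset Unit).erase () = ∅ := by
      rw [Fintype.univ_ofSubsingleton (), erase_singleton]
    rw [herase, prod_empty, mul_one]
    have hexp : Real.exp (-(min δ₁ 1 * treeLength (fun x y => tdistT (fine (L ^ jv.K) (kingVol L jv)) x y / (L : ℝ) ^ jv.K)
        (anchors fun _ : Unit => some (basePt (L ^ jv.K) (kingVol L jv) b₀)))) ≤ 1 := by
      rw [Real.exp_le_one_iff, neg_nonpos]
      exact mul_nonneg (le_min hδ₁.le zero_le_one)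
        (treeLength_nonneg (fun x y => div_nonneg (tdistT_nonneg _ x y) (pow_nonneg (Nat.cast_nonneg L) _)) _)
    have hrest : 0 ≤ Real.exp 1 * (C₁ ^ m * C₂ ^ nn * D) := by positivity
    calc _ ≤ 1 * (Real.exp 1 * (C₁ ^ m * C₂ ^ nn * D)) := mul_le_mul_of_nonneg_right hexp hrest
      _ = Real.exp 1 * (C₁ ^ m * C₂ ^ nn) * D := by ring
      _ ≤ A * (A ^ m * A ^ nn) * D := by
          refine mul_le_mul_of_nonneg_right (mul_le_mul heA (mul_le_mul (pow_le_pow_left₀ hC₁.le hC₁A m)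
            (pow_le_pow_left₀ hC₂.le hC₂A nn) (pow_nonneg hC₂.le _) (pow_nonneg hA0 _)) (by positivity) hA0) hD0
      _ = A ^ (m + nn + 1) * D := by rw [pow_add, pow_add, pow_one]; ring
  have hLo : graphValLS ((((L : ℝ) ^ jv.K)⁻¹) ^ (d + 1)) src tgt (fun ℓ => kingGLine L (kingVol L jv) a msq jv.K (κ ℓ))
        (fun _ : Unit => (0 : Fin (nn + 1))) (fun _ _ => (1 : ℝ))
      = ∑ b₀ : Tor (kingVol L jv), graphValLS ((((L : ℝ) ^ jv.K)⁻¹) ^ (d + 1)) src tgt (fun ℓ => kingGLine L (kingVol L jv) a msq jv.K (κ ℓ))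
        (fun _ : Unit => (0 : Fin (nn + 1))) (fun _ => blockIndLo L jv b₀) := by
    have h1 : (fun (_ : Unit) (_ : Tor (fine (L ^ jv.K) (kingVol L jv))) => (1 : ℝ))
        = fun _ x => ∑ b₀ : Tor (kingVol L jv), blockIndLo L jv b₀ x := by
      funext υ x; rw [sum_blockIndLo_eq_one]
    rw [h1, graphValLS_unit_sum]
  rw [hLo]
  refine (abs_sum_le_sum_abs _ _).trans ((sum_le_sum fun b₀ _ => hpin b₀).trans ?_)
  rw [sum_const, card_univ, nsmul_eq_mul]

end Vacuum

end Summit.QuantumFields.YangMills.BalabanUVNodes.N15KingModelRung.Curved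

end
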